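import Summits.ABC.FunctionField.TransferSheet
import Literature.Barriers.ABC.NoArithmeticDerivativeProofs
import Literature.Barriers.ABC.NoArithmeticDerivativeAbcEstimateProofs
import Mathlib.Analysis.SpecialFunctions.Pow.Asymptotics
import HarnessLib
import HarnessLib.Audit

/-!
# Cell abc-ff — transfer sheet, chain (c): the all-triples envelope of the Small-Derivatives requirement
# is FALSE under Schinzel's Hypothesis H (lens-3's rigid family `(1, p², p² + 1)`)

`Summits/ABC/FunctionField/TransferSheetMasonRigid.lean` (cell abc-ff; mathematics and Lean by the
cell's MASON lens seat abc-ff-lens-3, `HOME/lens-3/MasonSheet.lean` §C, farm rc 0; landed by the typer).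
HONESTY: abc is not proved by any of this; `InfinitelyManyPrimePairsSqHalf` is an OPEN hypothesis
(an instance of Schinzel's Hypothesis H), used only as a hypothesis; typed ≠ proved.

Content (rows MS-5 / CF-3′ of the sheet, the «why it might fail» cell made into theorems):
* `exists_large_value_of_adapted_one_sq` — **rigidity lemma (PROVED, elementary)**: for primes `p, q`
  with `p² + 1 = 2q`, every adapted (`Pasten.IsAdapted ψ 1 (p²)`), independent arithmetic derivative on
  the coprime non-excluded triple `(1, p², 2q)` has a value `|ψ r| ≥ p/8 ≈ c^{1/2}/8`, although
  `rad(abc) = 2pq > c` (not an abc-hit): the minimal independent derivative is NOT governed by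
  `c / rad(abc)`;
* `InfinitelyManyPrimePairsSqHalf` — the hypothesis «infinitely many primes `p` with `(p²+1)/2` prime»
  (`p = 3, 5, 11, 19, 29, 59, 61, 71, 79, …`);
* `not_smallDerivativesWith_of_lt_half` — under it, Pasten's `SmallDerivativesConjectureWith η` is
  FALSE for every `0 < η < 1/2`; hence `not_smallDerivativesAllExponents_of_hypothesisH`: the sheet's
  all-triples envelope `SmallDerivativesAllExponents` (the verbatim `η → 0⁺` transfer of row MS-5) is
  false under Hypothesis H — which is WHY the abc-relevant requirement is the hits-only
  `SmallDerivativesOnHitsAllExponents` of `TransferSheetMason.lean` (these triples are not hits).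
Nothing here bears on `ABC` itself; it sharpens the requirement row.
-/

noncomputable section

open Literature.NumberTheory.DiophantineGeometry
open Literature.Barriers.ABC

namespace Summit.ABC.FunctionField

/-! ### The rigid family `(1, p², 2q)`, `q = (p² + 1)/2`: large derivatives are FORCED -/

/-- **Rigidity lemma (new; elementary).** For primes `p, q` with `p² + 1 = 2q`, every `ψ ∈ 𝒯(1, p²)` with
`1, p²` `ψ`-independent has a value of size `≥ p/8` (indeed `d^ψ(p²) = 2p·ψ_p`, `d^ψ(2q) = 2ψ_q + qψ_2`,
adaptedness `2ψ_q + qψ_2 = 2pψ_p`, independence `ψ_p ≠ 0`; if `ψ_2 = 0` then `ψ_q = pψ_p`, else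
`q ≤ (2p + 2)·max(|ψ_p|, |ψ_q|)`). So `‖ψ‖ ≥ p/8 ≈ c^{1/2}/8` on this (non-excluded, coprime) triple,
although `rad(abc) = 2pq > c`: the minimal independent derivative is NOT governed by `c/rad(abc)`.
[folklore] -/
theorem exists_large_value_of_adapted_one_sq {p q : ℕ} (hp : p.Prime) (hq : q.Prime)
    (hpq : p ^ 2 + 1 = 2 * q) (ψ : ℕ → ℤ) (had : Pasten.IsAdapted ψ 1 (p ^ 2))
    (hW : Pasten.wronskian ψ 1 (p ^ 2) ≠ 0) :
    ∃ r : ℕ, (p : ℝ) / 8 ≤ |(ψ r : ℝ)| := by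
  have d1 : arithDerivWith ψ 1 = 0 := by simp [arithDerivWith]
  have dp2 : arithDerivWith ψ (p ^ 2) = 2 * (p : ℚ) * (ψ p : ℚ) := by
    rw [sq, arithDerivWith_mul, arithDerivWith_prime ψ hp]; ring
  have d2q : arithDerivWith ψ (2 * q) = 2 * (ψ q : ℚ) + (q : ℚ) * (ψ 2 : ℚ) := by
    rw [arithDerivWith_mul, arithDerivWith_prime ψ hq, arithDerivWith_prime ψ Nat.prime_two]
    push_cast; ring
  have heq : 2 * (ψ q : ℚ) + (q : ℚ) * (ψ 2 : ℚ) = 2 * (p : ℚ) * (ψ p : ℚ) := by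
    have h := had.2
    rw [show 1 + p ^ 2 = 2 * q by omega, d2q, d1, dp2] at h
    linarith
  have hx : ψ p ≠ 0 := by
    intro h0
    apply hW
    unfold Pasten.wronskian
    rw [dp2, d1, h0]
    simp
  have heqZ : 2 * ψ q + (q : ℤ) * ψ 2 = 2 * (p : ℤ) * ψ p := by exact_mod_cast heq
  have heqR : 2 * (ψ q : ℝ) + (q : ℝ) * (ψ 2 : ℝ) = 2 * (p : ℝ) * (ψ p : ℝ) := by
    exact_mod_cast heqZ
  have hp0 : (0 : ℝ) ≤ p := Nat.cast_nonneg p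
  by_cases hy : ψ 2 = 0
  · refine ⟨q, ?_⟩
    have hzq : (ψ q : ℝ) = (p : ℝ) * (ψ p : ℝ) := by
      have h : (ψ 2 : ℝ) = 0 := by exact_mod_cast hy
      rw [h] at heqR; linarith
    have h1 : (1 : ℝ) ≤ |(ψ p : ℝ)| := by exact_mod_cast Int.one_le_abs hx
    rw [hzq, abs_mul, abs_of_nonneg hp0]
    nlinarith
  · have hy1 : (1 : ℝ) ≤ |(ψ 2 : ℝ)| := by exact_mod_cast Int.one_le_abs hy
    set B : ℝ := max |(ψ p : ℝ)| |(ψ q : ℝ)| with hB_def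
    have hBp : |(ψ p : ℝ)| ≤ B := le_max_left _ _
    have hBq : |(ψ q : ℝ)| ≤ B := le_max_right _ _
    have hq0 : (0 : ℝ) ≤ q := Nat.cast_nonneg q
    have hqB : (q : ℝ) ≤ (2 * p + 2) * B := by
      have h2 : |(q : ℝ) * (ψ 2 : ℝ)| = |2 * (p : ℝ) * (ψ p : ℝ) - 2 * (ψ q : ℝ)| := by
        congr 1; linarith
      calc (q : ℝ) ≤ (q : ℝ) * |(ψ 2 : ℝ)| := le_mul_of_one_le_right hq0 hy1
        _ = |(q : ℝ) * (ψ 2 : ℝ)| := by rw [abs_mul, abs_of_nonneg hq0]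
        _ = |2 * (p : ℝ) * (ψ p : ℝ) - 2 * (ψ q : ℝ)| := h2
        _ ≤ |2 * (p : ℝ) * (ψ p : ℝ)| + |2 * (ψ q : ℝ)| := abs_sub _ _
        _ = 2 * (p : ℝ) * |(ψ p : ℝ)| + 2 * |(ψ q : ℝ)| := by
            rw [abs_mul, abs_mul, abs_mul, abs_of_nonneg hp0, abs_two]
        _ ≤ 2 * (p : ℝ) * B + 2 * B := by
            have := mul_le_mul_of_nonneg_left hBp (by positivity : (0 : ℝ) ≤ 2 * p)
            linarith
        _ = (2 * p + 2) * B := by ring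
    have h2q : 2 * (q : ℝ) = (p : ℝ) ^ 2 + 1 := by exact_mod_cast hpq.symm
    have hB : (p : ℝ) / 8 ≤ B := by
      by_contra hlt
      push Not at hlt
      have h4 : 0 ≤ 2 * (p : ℝ) + 2 := by positivity
      have := mul_le_mul_of_nonneg_left hqB (show (0:ℝ) ≤ 2 by norm_num)
      nlinarith [mul_lt_mul_of_pos_left hlt (by positivity : (0 : ℝ) < 2 * p + 2), sq_nonneg ((p : ℝ) - 1)]
    rcases le_total |(ψ p : ℝ)| |(ψ q : ℝ)| with h | h
    · exact ⟨q, hB.trans (max_le h le_rfl)⟩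
    · exact ⟨p, hB.trans (max_le le_rfl h)⟩

/-- Upper bound companion: on `(1, p², 2q)` the vector `ψ₀ = (ψ_p, ψ_q) = (1, p)` (all other values `0`)
is adapted and independent with `‖ψ₀‖ = p`, so the minimal independent adapted derivative of this family
is `Θ(p) = Θ(c^{1/2})` EXACTLY: the family refutes `SDC(η)` for `η < 1/2` (given H) and is consistent with
it for `η > 1/2`. [folklore] -/
theorem exists_small_adapted_independent_one_sq {p q : ℕ} (hp : p.Prime) (hq : q.Prime)
    (hpq : p ^ 2 + 1 = 2 * q) :
    ∃ ψ : ℕ → ℤ, Pasten.IsAdapted ψ 1 (p ^ 2) ∧ Pasten.wronskian ψ 1 (p ^ 2) ≠ 0 ∧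
      ∀ r : ℕ, |ψ r| ≤ (p : ℤ) := by
  have hp2 : 2 ≤ p := hp.two_le
  have hq2 : 2 ≤ q := hq.two_le
  have hpq' : p ≠ q := by
    intro h; subst h; nlinarith
  have hp_ne2 : p ≠ 2 := by
    intro h; subst h; omega
  have hq_ne2 : q ≠ 2 := by
    intro h; subst h
    have : p ^ 2 = 3 := by omega
    nlinarith
  let ψ : ℕ → ℤ := fun r => if r = p then 1 else if r = q then (p : ℤ) else 0
  have hψp : ψ p = 1 := by simp [ψ]
  have hψq : ψ q = (p : ℤ) := by simp [ψ, Ne.symm hpq']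
  have hψ2 : ψ 2 = 0 := by simp [ψ, Ne.symm hp_ne2, Ne.symm hq_ne2]
  have d1 : arithDerivWith ψ 1 = 0 := by simp [arithDerivWith]
  have dp2 : arithDerivWith ψ (p ^ 2) = 2 * (p : ℚ) := by
    rw [sq, arithDerivWith_mul, arithDerivWith_prime ψ hp, hψp]; push_cast; ring
  have d2q : arithDerivWith ψ (2 * q) = 2 * (p : ℚ) := by
    rw [arithDerivWith_mul, arithDerivWith_prime ψ hq, arithDerivWith_prime ψ Nat.prime_two, hψq, hψ2]
    push_cast; ring
  refine ⟨ψ, ⟨?_, ?_⟩, ?_, ?_⟩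
  · intro r hr
    have hr' : r = p ∨ r = q := by
      by_contra hcon
      push Not at hcon
      apply hr
      simp [ψ, hcon.1, hcon.2]
    rcases hr' with rfl | rfl
    · exact ⟨hp, Dvd.intro (r * (1 + r ^ 2)) (by ring)⟩
    · refine ⟨hq, ?_⟩
      rw [show 1 + p ^ 2 = 2 * r by omega]
      exact Dvd.intro_left (1 * p ^ 2 * 2) (by ring)
  · rw [show 1 + p ^ 2 = 2 * q by omega, d2q, d1, dp2]; ring
  · unfold Pasten.wronskian
    rw [dp2, d1]
    have : (p : ℚ) ≠ 0 := by exact_mod_cast hp.ne_zero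
    simp [this]
  · intro r
    by_cases h1 : r = p
    · simp [ψ, h1]; exact_mod_cast le_trans (by norm_num) hp2
    · by_cases h2 : r = q
      · subst h2; rw [hψq]; simp
      · simp [ψ, h1, h2]

/-- Asymptotic input: for `0 < η < 1/2`, `(1 + p²)^η < p/8` for all `p ≥ N₁(η)`. [folklore] -/
theorem exists_rpow_one_add_sq_lt {η : ℝ} (hη0 : 0 < η) (hη : η < 1 / 2) :
    ∃ N₁ : ℝ, ∀ p : ℕ, N₁ ≤ (p : ℝ) → (((1 + p ^ 2 : ℕ) : ℝ)) ^ η < (p : ℝ) / 8 := by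
  set e : ℝ := 1 - 2 * η with he
  have he0 : 0 < e := by rw [he]; linarith
  refine ⟨max 1 ((17 : ℝ) ^ (1 / e)), fun p hp => ?_⟩
  have hp1 : (1 : ℝ) ≤ p := le_trans (le_max_left _ _) hp
  have hp0 : (0 : ℝ) < p := by linarith
  have hpe : (17 : ℝ) ≤ (p : ℝ) ^ e := by
    have h1 : (17 : ℝ) ^ (1 / e) ≤ p := le_trans (le_max_right _ _) hp
    have h2 := Real.rpow_le_rpow (by positivity) h1 he0.le
    rwa [← Real.rpow_mul (by norm_num : (0:ℝ) ≤ 17), one_div_mul_cancel he0.ne',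
      Real.rpow_one] at h2
  have hsplit : (p : ℝ) = (p : ℝ) ^ (2 * η) * (p : ℝ) ^ e := by
    rw [← Real.rpow_add hp0, show 2 * η + e = 1 by rw [he]; ring, Real.rpow_one]
  have hpos : 0 < (p : ℝ) ^ (2 * η) := Real.rpow_pos_of_pos hp0 _
  have hc : (((1 + p ^ 2 : ℕ) : ℝ)) ^ η ≤ 2 * (p : ℝ) ^ (2 * η) := by
    have hcast : (((1 + p ^ 2 : ℕ) : ℝ)) = 1 + (p : ℝ) ^ 2 := by push_cast; ring
    rw [hcast]
    have h2η : (2 : ℝ) ^ η ≤ 2 := by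
      calc (2 : ℝ) ^ η ≤ (2 : ℝ) ^ (1 : ℝ) :=
            Real.rpow_le_rpow_of_exponent_le (by norm_num) (by linarith)
        _ = 2 := Real.rpow_one 2
    have hp2η : ((p : ℝ) ^ 2) ^ η = (p : ℝ) ^ (2 * η) := by
      rw [← Real.rpow_two, ← Real.rpow_mul hp0.le]
    calc (1 + (p : ℝ) ^ 2) ^ η ≤ (2 * (p : ℝ) ^ 2) ^ η :=
          Real.rpow_le_rpow (by positivity) (by nlinarith) hη0.le
      _ = (2 : ℝ) ^ η * ((p : ℝ) ^ 2) ^ η := Real.mul_rpow (by norm_num) (by positivity)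
      _ ≤ 2 * ((p : ℝ) ^ 2) ^ η := mul_le_mul_of_nonneg_right h2η (by positivity)
      _ = 2 * (p : ℝ) ^ (2 * η) := by rw [hp2η]
  calc (((1 + p ^ 2 : ℕ) : ℝ)) ^ η ≤ 2 * (p : ℝ) ^ (2 * η) := hc
    _ < (p : ℝ) ^ (2 * η) * (p : ℝ) ^ e / 8 := by
        nlinarith [mul_nonneg hpos.le (sub_nonneg.mpr hpe)]
    _ = (p : ℝ) / 8 := by rw [← hsplit]

/-- **An instance of Schinzel's Hypothesis H / Bateman–Horn** (OPEN, believed): there are infinitely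
many primes `p` with `(p² + 1)/2` prime (`p = 3, 5, 11, 19, 29, 59, 61, 71, 79, …`). Used only as a
HYPOTHESIS (Schinzel–Sierpiński 1958, Hypothesis H; Bateman–Horn). [folklore] -/
@[conjecture] def InfinitelyManyPrimePairsSqHalf : Prop :=
  ∀ N : ℕ, ∃ p q : ℕ, N < p ∧ p.Prime ∧ q.Prime ∧ p ^ 2 + 1 = 2 * q

/-- **The Small Derivatives Conjecture with ANY exponent `η < 1/2` contradicts Hypothesis H (new).**
Each pair `p, q = (p² + 1)/2` of primes gives the coprime, NON-excluded triple `(1, p², 2q)` on which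
every adapted independent `ψ` has `‖ψ‖ ≥ p/8 > c^η` once `p ≥ N₁(η)`
(`exists_large_value_of_adapted_one_sq`); infinitely many pairs exceed any finite exceptional set.
Hence Pasten's conjecture can only hold in the window `η ≥ 1/2` (he asks for SOME `η < 1`), and
`R1 = SmallDerivativesAllExponents` — the hypothesis the Mason transfer needs for exponent `1 + ε` —
is false under Hypothesis H. (These triples have `rad(abc) = 2pq > c`: they are irrelevant to abc,
which is why the abc-relevant repair below restricts to `rad(abc) < c`.) [folklore] -/
theorem not_smallDerivativesWith_of_lt_half (hH : InfinitelyManyPrimePairsSqHalf)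
    {η : ℝ} (hη0 : 0 < η) (hη : η < 1 / 2) : ¬ Pasten.SmallDerivativesConjectureWith η := by
  intro hfin
  set S : Set (ℕ × ℕ × ℕ) := {t : ℕ × ℕ × ℕ | IsABCTriple t.1 t.2.1 t.2.2 ∧
      ¬ Pasten.IsExcludedTriple t.1 t.2.1 t.2.2 ∧
      ¬ ∃ ψ : ℕ → ℤ, Pasten.IsAdapted ψ t.1 t.2.1 ∧ Pasten.wronskian ψ t.1 t.2.1 ≠ 0 ∧
          ∀ p : ℕ, (|ψ p| : ℝ) < (t.2.2 : ℝ) ^ η} with hS_def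
  have hSfin : S.Finite := hfin
  obtain ⟨N₀, hN₀⟩ := (hSfin.image fun t : ℕ × ℕ × ℕ => t.2.2).bddAbove
  obtain ⟨N₁, hN₁⟩ := exists_rpow_one_add_sq_lt hη0 hη
  obtain ⟨p, q, hNp, hp, hq, hpq⟩ := hH (max N₀ ⌈N₁⌉₊)
  have hp2 : 2 ≤ p := hp.two_le
  have hq2 : 2 ≤ q := hq.two_le
  have hN0p : N₀ < p := lt_of_le_of_lt (le_max_left _ _) hNp
  have hN1p : N₁ ≤ (p : ℝ) := by
    have h1 : ⌈N₁⌉₊ ≤ p := (le_max_right _ _).trans hNp.le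
    exact (Nat.le_ceil N₁).trans (by exact_mod_cast h1)
  -- the triple (1, p², 1 + p²) is an abc triple, not excluded, and too large to be exceptional
  have habc : IsABCTriple 1 (p ^ 2) (1 + p ^ 2) :=
    ⟨Nat.one_pos, pow_pos hp.pos 2, rfl, Nat.coprime_one_left _⟩
  have hnex : ¬ Pasten.IsExcludedTriple 1 (p ^ 2) (1 + p ^ 2) := by
    have hnp2 : ¬ (p ^ 2).Prime := by
      rw [sq]; exact Nat.not_prime_mul hp.ne_one hp.ne_one
    have hnc : ¬ (1 + p ^ 2).Prime := by
      rw [show 1 + p ^ 2 = 2 * q by omega]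
      exact Nat.not_prime_mul (by norm_num) hq.ne_one
    have hp21 : p ^ 2 ≠ 1 := by nlinarith
    rintro (⟨-, h | h⟩ | ⟨h, -⟩)
    · exact hnp2 h
    · exact hnc h
    · exact hp21 h
  have hmem : (1, p ^ 2, 1 + p ^ 2) ∉ S := by
    intro hmem
    have hc : 1 + p ^ 2 ≤ N₀ :=
      hN₀ (Set.mem_image_of_mem (fun t : ℕ × ℕ × ℕ => t.2.2) hmem)
    nlinarith
  have hψ : ∃ ψ : ℕ → ℤ, Pasten.IsAdapted ψ 1 (p ^ 2) ∧ Pasten.wronskian ψ 1 (p ^ 2) ≠ 0 ∧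
      ∀ r : ℕ, (|ψ r| : ℝ) < (((1 + p ^ 2 : ℕ) : ℝ)) ^ η := by
    by_contra h
    exact hmem ⟨habc, hnex, h⟩
  obtain ⟨ψ, had, hW, hsmall⟩ := hψ
  obtain ⟨r, hr⟩ := exists_large_value_of_adapted_one_sq hp hq hpq ψ had hW
  have h1 := hsmall r
  have h2 := hN₁ p hN1p
  push_cast at h1 h2 hr
  linarith


/-- **Under Hypothesis H the sheet's all-triples envelope `SmallDerivativesAllExponents` is false**
(`η = 1/4` in `not_smallDerivativesWith_of_lt_half`); the hits-only envelope
`SmallDerivativesOnHitsAllExponents` is untouched (the witnesses have `rad(abc) > c`). [folklore] -/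
theorem not_smallDerivativesAllExponents_of_hypothesisH (hH : InfinitelyManyPrimePairsSqHalf) :
    ¬ SmallDerivativesAllExponents := fun h =>
  not_smallDerivativesWith_of_lt_half hH (by norm_num : (0 : ℝ) < 1 / 4)
    (by norm_num : (1 : ℝ) / 4 < 1 / 2) (h (1 / 4) (by norm_num))

end Summit.ABC.FunctionField

end
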